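import Literature.Topology.FourManifolds.TautFoliationsCollarRingChain
import Literature.Topology.FourManifolds.TautFoliationsRadialPaths
import HarnessLib

/-!
# Set-up for the image computation of the contour leaf of the coned collar

Sibling of `TautFoliationsCollarRingChain.lean` (plan (d) F4, set-up). (1) A radius generic for
both the vertices and the grid lines (`exists_generic_radius'`: finitely many bad radii in an
interval). (2) For an even mesh, the starting point `ringParam c₀ R 0 = c₀ + (R, 0)` of the
angular ring parametrisation lies on the 1-skeleton (`ringParam_zero_mem_skeleton`: the ordinate
of `c₀` is a grid ordinate), so it is a crossing, a point of the wiggly ring, and the base point of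
the compact contour leaf of `exists_isCompact_leaf_collar`-type statements.

* `exists_generic_radius'`, `ringParam_zero_mem_skeleton` (**proved**).

All statements are [folklore].
-/

noncomputable section

open Set Filter Metric Topology Function Real
open scoped unitInterval
open Literature.Topology.PlanarFoliations

namespace Literature.Topology.FourManifolds

namespace Foliation.ConePosition

open SquareGrid SquareGrid.Grid SquarePolar ConeSquare CollarRadius

variable {B : Type*} [NormedAddCommGroup B] {M : Type*} [TopologicalSpace M] {F : Foliation B M}
variable {c₀ : ℝ × ℝ} {L : ℝ} {hL : 0 < L} {G : ℝ × ℝ → M}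
variable (P : ConePosition F G c₀ hL)

/-- **A radius generic for the vertices and the grid lines**, in `[15L/16, 31L/32]`, with
`R + 2ℓ < L` (mesh `≥ 128`). [folklore] -/
theorem exists_generic_radius' (hn : 128 ≤ P.n) :
    ∃ R, 15 * L / 16 ≤ R ∧ R ≤ 31 * L / 32 ∧ (∀ v ∈ P.gr.vertices, dist v c₀ ≠ R) ∧
      (∀ A ∈ P.gr.lines₁, |A - c₀.1| ≠ R) ∧ (∀ A ∈ P.gr.lines₂, |A - c₀.2| ≠ R) ∧ R + 2 * P.gr.ℓ < L := by
  have hℓ : P.gr.ℓ = L / P.n := grid_ℓ hL P.hn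
  have hn' : (128 : ℝ) ≤ P.n := by exact_mod_cast hn
  have hℓle : P.gr.ℓ ≤ L / 128 := by rw [hℓ]; exact div_le_div_of_nonneg_left hL.le (by norm_num) hn'
  have hfin : (((fun v : ℝ × ℝ ↦ dist v c₀) '' P.gr.vertices) ∪ ((fun A ↦ |A - c₀.1|) '' P.gr.lines₁) ∪
      ((fun A ↦ |A - c₀.2|) '' P.gr.lines₂)).Finite :=
    ((P.gr.finite_vertices.image _).union (P.gr.finite_lines₁.image _)).union (P.gr.finite_lines₂.image _)
  have hinf : (Ioo (15 * L / 16) (31 * L / 32)).Infinite := Ioo_infinite (by linarith)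
  obtain ⟨R, hRI, hRnot⟩ := (hinf.sdiff hfin).nonempty
  refine ⟨R, hRI.1.le, hRI.2.le, fun v hv h ↦ hRnot (Or.inl (Or.inl ⟨v, hv, h⟩)),
    fun A hA h ↦ hRnot (Or.inl (Or.inr ⟨A, hA, h⟩)), fun A hA h ↦ hRnot (Or.inr ⟨A, hA, h⟩), ?_⟩
  linarith [hRI.2]

/-- **For an even mesh, the starting point of the ring parametrisation is on the 1-skeleton.**
[folklore] -/
theorem ringParam_zero_mem_skeleton (heven : Even P.n) {R : ℝ} (hR0 : 0 ≤ R) (hRL : R ≤ L) :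
    ringParam c₀ R 0 ∈ P.gr.skeleton := by
  have hℓpos := P.gr.hℓ
  obtain ⟨hc, hnl⟩ := grid_bigCentre (c₀ := c₀) hL P.hn
  set x₀ := ringParam c₀ R 0 with hx₀
  have hx₀eq : x₀ = c₀ + ((R, 0) : ℝ × ℝ) := ringParam_zero
  have hx₀S : x₀ ∈ P.gr.S := by
    rw [show P.gr.S = closedBall c₀ L from grid_S hL P.hn, mem_closedBall, hx₀, dist_ringParam hR0]; exact hRL
  obtain ⟨q, hq⟩ := P.gr.exists_mem_sq hx₀S
  refine (P.gr.mem_skeleton_iff).2 ⟨q, (P.gr.mem_sphere_centre_iff).2 ⟨hq, ?_⟩⟩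
  -- the ordinate of `c₀` is the grid ordinate of index `n / 2`
  obtain ⟨k, hk⟩ := heven
  have hc2 : c₀.2 = P.gr.a.2 + 2 * (k : ℝ) * P.gr.ℓ := by
    have h1 : c₀.2 = P.gr.bigCentre.2 := by rw [hc]
    have h2 : P.gr.bigCentre.2 = P.gr.a.2 + P.gr.n * P.gr.ℓ := rfl
    have h3 : (P.gr.n : ℝ) = 2 * k := by
      have : P.gr.n = P.n := rfl
      rw [this, hk]; push_cast; ring
    rw [h1, h2, h3]
  have hx₀2 : x₀.2 = c₀.2 := by rw [hx₀eq]; simp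
  -- `x₀.2` is between the bottom and top ordinates of `q`: it is one of them
  have hsq := (P.gr.mem_sq_iff).1 hq
  have h3 := hsq.2.2.1; have h4 := hsq.2.2.2
  rw [hx₀2, hc2] at h3 h4
  -- integer comparison: `q.2 ≤ k ≤ q.2 + 1`
  have hk1 : ((q.2 : ℕ) : ℝ) ≤ k := by nlinarith
  have hk2 : (k : ℝ) ≤ (q.2 : ℕ) + 1 := by nlinarith
  have hk1' : (q.2 : ℕ) ≤ k := by exact_mod_cast hk1
  have hk2' : k ≤ (q.2 : ℕ) + 1 := by exact_mod_cast hk2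
  rcases Nat.eq_or_lt_of_le hk1' with h | h
  · right; right; left
    rw [hx₀2, hc2, ← h]
  · have hkeq : k = (q.2 : ℕ) + 1 := le_antisymm hk2' h
    right; right; right
    rw [hx₀2, hc2, hkeq]; push_cast; ring

end Foliation.ConePosition

end Literature.Topology.FourManifolds
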